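import Summits.QuantumFields.YangMills.Theorems.LuscherReductionRunningReductionCoarseUpperPrelim
import Summits.QuantumFields.YangMills.Theorems.FemtoTransferGapLevelsPos
import Summits.QuantumFields.YangMills.Theorems.LuscherReductionOneSiteLevelsIMS
import Summits.QuantumFields.YangMills.Theorems.LuscherReductionDressedRitzVacuumDictionary
import Summits.QuantumFields.YangMills.Theorems.LuscherReductionDressedRitzOfOperatorPlateau
import Summits.QuantumFields.YangMills.Theorems.FlatTubeReductionOffTubeSuppressionPrelim
import Summits.QuantumFields.YangMills.Theorems.LuscherReductionTwistedTraceScalingBOAssemblyPrelim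
import HarnessLib

/-!
# CLUSTER ABSORPTION: `⟨ΨW, K_β ΨW⟩ ≤ λ_k·(1 + O(second moments))·‖Ψ‖²` once the dressing `sup|W²−1|` on the window is absorbed by the gap below a cluster
# (abstract heart of the dressed one-site no-intruder `BORateBricksD.hDS`; route `FlatTubeReduction`, crux K1 `NearFlatRatioLaw` stmt-QuantumFields-24720; seat
# `ym-line-ftr-p1` g10; R2b1 RECORD rung — no summit statement is proved here)

WHY: crux workfile `Cruxes/NearFlatRatioLaw/Lines/ratepack-dressing-g10.md` §3 — the SLOW-with-rate clause needs the min–max levels of the DRESSED one-site operator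
`W K_B W` on the window (`|W² − 1| ≤ κ_W·dist²`, `W > 1` off the vacuum for `L ≥ 3`) to be `≤ e^{Cλ_b²}μ_k`; localisation cannot give it (an eigen-scale cut costs `O(λ_b)`).
What does: split `ψ = ΨW` along the EXACT eigenfamily `e₀,…,e_n` of `K_β` (tree: `exists_isPhys_eigenfamily_dominating_of_pos`) — no cross term — so that (§2)
`⟨ψ,Kψ⟩ ≤ λ_n‖ψ‖² + (λ_k − λ_n)Σ_{i<n}⟨ψ,e_i⟩²` for `ψ ⊥ e_{<k}`; the dressing excess `∫(W²−1)Ψ²` OFF `span(e_{<n})` is weighted by `λ_n` and ABSORBED by the gap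
(`2κ̄λ_n ≤ λ_k − λ_n`), the part ON the span costs the dressed second-moment form `V` of the eigenfunctions and the overlaps `w² ≥ Σ‖𝟙_S(W−1)e_i‖²` (§3):
  ★★★ `qform_dressed_le_of_cluster`: `⟨ΨW, K_β ΨW⟩ ≤ (λ_k + 2λ_nV + (λ_k − λ_n)(2w + w²))·‖Ψ‖²` for physical `Ψ` supported in the invariant window `S`, `ΨW ⊥ e_{<k}`.
With `V, w` from one-site eigenfunction second moments (the NEW input (EM)) and `λ_k − λ_n ≍ λ_bλ_k` (crux ONE + `LuscherSimonGap_holds`) this is `e^{Cλ_b²}λ_k‖Ψ‖²`.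
* §1 `sum_add_sq_le`, `absorb_arith`; §2 ★ `qform_le_two_level`; §3 ★★★ `qform_dressed_le_of_cluster` (any `L`; the one-site model is `L = 1`).
HONEST FRAMING: fixed-lattice linear algebra over tree objects (Reed–Simon XIII.1); (EM) and the fibre bricks stay OPEN; femto rung R2b1 (RECORD label); not infinite volume,
not a gap, not Clay.  No defs, no named facts, no `sorry`.
-/

set_option autoImplicit false

noncomputable section

open MeasureTheory Filter Topology Real
open scoped BigOperators
open Literature.MathematicalPhysics.QuantumFieldTheory
open Literature.MathematicalPhysics.QuantumLattice

namespace Summit.QuantumFields.YangMills.Theorems.FemtoTransferGap.RateTube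

open Summit.QuantumFields.YangMills.Theorems.FemtoTransferGap
open Summit.QuantumFields.YangMills.Theorems.FemtoTransferGap.OffTube
open Summit.QuantumFields.YangMills.Theorems.FemtoTransferGap.TwoLattice.ConstTube (l2_self_eq_integral_sq)

variable {L : ℕ} [NeZero L]

/-! ## §1 Two elementary inequalities -/

omit [NeZero L] in
/-- Discrete Minkowski: `Σ (aᵢ + bᵢ)² ≤ (√Σaᵢ² + √Σbᵢ²)²`. [folklore] -/
theorem sum_add_sq_le {ι : Type*} (s : Finset ι) (a b : ι → ℝ) :
    ∑ i ∈ s, (a i + b i) ^ 2 ≤ (Real.sqrt (∑ i ∈ s, a i ^ 2) + Real.sqrt (∑ i ∈ s, b i ^ 2)) ^ 2 := by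
  have hA : 0 ≤ ∑ i ∈ s, a i ^ 2 := Finset.sum_nonneg fun i _ => sq_nonneg _
  have hB : 0 ≤ ∑ i ∈ s, b i ^ 2 := Finset.sum_nonneg fun i _ => sq_nonneg _
  have hcs : (∑ i ∈ s, a i * b i) ^ 2 ≤ (∑ i ∈ s, a i ^ 2) * ∑ i ∈ s, b i ^ 2 := Finset.sum_mul_sq_le_sq_mul_sq s a b
  have hab : ∑ i ∈ s, a i * b i ≤ Real.sqrt (∑ i ∈ s, a i ^ 2) * Real.sqrt (∑ i ∈ s, b i ^ 2) := by
    rw [← Real.sqrt_mul hA]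
    exact (le_abs_self _).trans (Real.abs_le_sqrt hcs)
  have hexp : ∑ i ∈ s, (a i + b i) ^ 2 = ∑ i ∈ s, a i ^ 2 + 2 * ∑ i ∈ s, a i * b i + ∑ i ∈ s, b i ^ 2 := by
    rw [Finset.mul_sum, ← Finset.sum_add_distrib, ← Finset.sum_add_distrib]
    exact Finset.sum_congr rfl fun i _ => by ring
  rw [hexp, add_sq, Real.sq_sqrt hA, Real.sq_sqrt hB]
  nlinarith [hab]

omit [NeZero L] in
/-- The real-number endgame of the absorption: with `0 ≤ p ≤ N`, `X ≤ 2Vp + 2κ̄(N − p)`, `c ≤ (√p + w√N)²`, `Q ≤ lₙ(N + X) + (l_k − lₙ)c` and the GAP CONDITION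
`2κ̄lₙ ≤ l_k − lₙ` (`0 ≤ lₙ ≤ l_k`, `V, w ≥ 0`): `Q ≤ (l_k + 2lₙV + (l_k − lₙ)(2w + w²))·N`. [folklore] -/
theorem absorb_arith {Q N p X c V w κ lk ln : ℝ} (hN : 0 ≤ N) (hp0 : 0 ≤ p) (hpN : p ≤ N) (hV : 0 ≤ V) (hw : 0 ≤ w)
    (hln0 : 0 ≤ ln) (hlkn : ln ≤ lk) (hgap : 2 * κ * ln ≤ lk - ln)
    (hX : X ≤ 2 * V * p + 2 * κ * (N - p)) (hc : c ≤ (Real.sqrt p + w * Real.sqrt N) ^ 2) (hQ : Q ≤ ln * (N + X) + (lk - ln) * c) :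
    Q ≤ (lk + 2 * ln * V + (lk - ln) * (2 * w + w ^ 2)) * N := by
  have hsp : Real.sqrt p * Real.sqrt N ≤ N := by
    rw [← Real.sqrt_mul hp0]
    calc Real.sqrt (p * N) ≤ Real.sqrt (N * N) := Real.sqrt_le_sqrt (by nlinarith)
      _ = N := Real.sqrt_mul_self hN
  have hc' : c ≤ p + (2 * w + w ^ 2) * N := by
    have e : (Real.sqrt p + w * Real.sqrt N) ^ 2 = p + 2 * w * (Real.sqrt p * Real.sqrt N) + w ^ 2 * N := by
      rw [add_sq, Real.sq_sqrt hp0, mul_pow, Real.sq_sqrt hN]; ring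
    rw [e] at hc
    nlinarith [hc, hsp, hw]
  have hgap' : 0 ≤ lk - ln := by linarith
  have h1 : Q ≤ ln * N + ln * (2 * V * p + 2 * κ * (N - p)) + (lk - ln) * (p + (2 * w + w ^ 2) * N) := by
    have := mul_le_mul_of_nonneg_left hX hln0
    have := mul_le_mul_of_nonneg_left hc' hgap'
    nlinarith
  -- `lₙN + (l_k − lₙ)p = l_kN − (l_k − lₙ)(N − p)` and `2lₙκ(N − p) ≤ (l_k − lₙ)(N − p)`
  have h2 : ln * (2 * κ * (N - p)) ≤ (lk - ln) * (N - p) := by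
    have := mul_le_mul_of_nonneg_right hgap (by linarith : 0 ≤ N - p)
    nlinarith
  have h3 : ln * (2 * V * p) ≤ 2 * ln * V * N := by nlinarith [mul_nonneg hln0 hV]
  nlinarith [h1, h2, h3, mul_nonneg hgap' (by nlinarith [sq_nonneg w] : 0 ≤ (2 * w + w ^ 2) * N)]

/-! ## §2 ★ The two-level spectral bound off the first `k` exact eigenfunctions -/

/-- ★ **TWO-LEVEL SPECTRAL BOUND.**  For an `l2`-orthonormal physical exact eigenfamily `e₀,…,e_n` (`K_βe_i = λ_ie_i`, `λ_i = levelValue su2Rep L β i`)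
with Courant–Fischer domination (`ψ ⊥ e_{<j} ⇒ ⟨ψ,Kψ⟩ ≤ λ_j‖ψ‖²`, tree: `exists_isPhys_eigenfamily_dominating_of_pos`), and a physical `ψ ⊥ e₀,…,e_{k−1}` (`k ≤ n`):
`⟨ψ, K_βψ⟩ ≤ λ_n‖ψ‖² + (λ_k − λ_n)·Σ_{i<n} ⟨ψ, e_i⟩²` — the `K_β`-invariant splitting `ψ = Σ_{i<n}⟨ψ,e_i⟩e_i + ψ_Q` has no cross term, the span part has
Rayleigh quotient `≤ λ_k` (antitone levels, vanishing coefficients below `k`), the rest `≤ λ_n`. [cite: ReedSimonIV1978, Thm. XIII.1] -/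
theorem qform_le_two_level {β : ℝ} {n : ℕ} {e : Fin (n + 1) → GaugeConfig 3 L SU2 → ℝ} (he : ∀ i, IsPhys (e i))
    (hon : ∀ i l, l2 (e i) (e l) = if i = l then 1 else 0)
    (heig : ∀ i : Fin (n + 1), transferApply β (e i) = levelValue su2Rep L β (i : ℕ) • e i)
    (hdom : ∀ (j : Fin (n + 1)) (ψ : GaugeConfig 3 L SU2 → ℝ), IsPhys ψ → (∀ i : Fin (n + 1), i < j → l2 ψ (e i) = 0) →
      qform su2Rep β ψ ψ ≤ levelValue su2Rep L β j * l2 ψ ψ)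
    {k : ℕ} (hkn : k ≤ n) {ψ : GaugeConfig 3 L SU2 → ℝ} (hψ : IsPhys ψ) (hperp : ∀ i : Fin (n + 1), (i : ℕ) < k → l2 ψ (e i) = 0) :
    qform su2Rep β ψ ψ ≤ levelValue su2Rep L β n * l2 ψ ψ +
      (levelValue su2Rep L β k - levelValue su2Rep L β n) * ∑ i : Fin (n + 1), (if (i : ℕ) < n then l2 ψ (e i) else 0) ^ 2 := by
  classical
  set lam : ℕ → ℝ := fun j => levelValue su2Rep L β j with hlam
  -- domination at the last index, and monotonicity of the levels along the eigenfamily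
  have hdomn : ∀ ψ : GaugeConfig 3 L SU2 → ℝ, IsPhys ψ → (∀ i : Fin (n + 1), (i : ℕ) < n → l2 ψ (e i) = 0) →
      qform su2Rep β ψ ψ ≤ lam n * l2 ψ ψ := fun ψ' hψ' h' => by
    have := hdom (Fin.last n) ψ' hψ' (fun i hi => h' i (by simpa [Fin.lt_def, Fin.val_last] using hi))
    simpa [Fin.val_last] using this
  have hanti : ∀ i j : Fin (n + 1), i ≤ j → lam (j : ℕ) ≤ lam (i : ℕ) := fun i j hij => by
    have hq : qform su2Rep β (e j) (e j) = lam (j : ℕ) := by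
      rw [qform_eigen_right β (heig j), hon]; simp [hlam]
    have h1 : l2 (e j) (e j) = 1 := by rw [hon]; simp
    have h := hdom i (e j) (he j) (fun i' hi' => by
      rw [hon]; simp [show j ≠ i' from fun h => by rw [h] at hij; exact absurd (lt_of_lt_of_le hi' hij) (lt_irrefl _)])
    rw [hq, h1, mul_one] at h
    exact h
  -- coefficients and the splitting
  set c : Fin (n + 1) → ℝ := fun i => if (i : ℕ) < n then l2 ψ (e i) else 0 with hcdef
  set P : GaugeConfig 3 L SU2 → ℝ := fun U => ∑ i, c i * e i U with hPdef
  have hP : IsPhys P := isPhys_sum_mul_lat Finset.univ e he c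
  set Q : GaugeConfig 3 L SU2 → ℝ := fun U => ψ U - P U with hQdef
  have hQ : IsPhys Q := OpPlat.isPhys_sub hψ hP
  have hsplit : ψ = P + Q := by funext U; simp only [hQdef, Pi.add_apply]; ring
  -- coefficient facts
  have hcc : ∀ i, c i * l2 ψ (e i) = c i ^ 2 := fun i => by
    by_cases hi : (i : ℕ) < n <;> simp [hcdef, hi, sq]
  have hPe : ∀ i, l2 P (e i) = c i := fun i => by
    rw [hPdef, l2_sum_mul_left_lat Finset.univ e he c (he i)]
    rw [Finset.sum_eq_single i (fun j _ hji => by rw [hon]; simp [hji]) (fun h => (h (Finset.mem_univ i)).elim)]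
    rw [hon]; simp
  have hQe : ∀ i : Fin (n + 1), (i : ℕ) < n → l2 Q (e i) = 0 := fun i hi => by
    have e1 : Q = ψ + (-1 : ℝ) • P := by funext U; simp only [hQdef, Pi.add_apply, Pi.smul_apply, smul_eq_mul]; ring
    rw [e1, l2_add_left hψ (hP.smul _) (he i), l2_smul_left, hPe i]
    simp only [hcdef, hi, if_true]; ring
  have hψP : l2 ψ P = ∑ i, c i ^ 2 := by
    rw [l2_comm, hPdef, l2_sum_mul_left_lat Finset.univ e he c hψ]
    exact Finset.sum_congr rfl fun i _ => by rw [l2_comm]; exact hcc i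
  obtain ⟨hPP, hPKP⟩ := forms_of_eigenfamily_lat he hon heig c
  have hPQ : l2 P Q = 0 := by
    rw [hPdef, l2_sum_mul_left_lat Finset.univ e he c hQ]
    refine Finset.sum_eq_zero fun i _ => ?_
    by_cases hi : (i : ℕ) < n
    · rw [l2_comm, hQe i hi, mul_zero]
    · simp only [hcdef, hi, if_false, zero_mul]
  have hPKQ : qform su2Rep β P Q = 0 := by
    rw [hPdef, qform_sum_mul_left_lat Finset.univ β e he c hQ]
    refine Finset.sum_eq_zero fun i _ => ?_
    by_cases hi : (i : ℕ) < n
    · rw [qform_su2Rep_comm β (he i) hQ, qform_eigen_right β (heig i), hQe i hi, mul_zero, mul_zero]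
    · simp only [hcdef, hi, if_false, zero_mul]
  -- norms and forms of the pieces
  have hnorm : l2 ψ ψ = (∑ i, c i ^ 2) + l2 Q Q := by
    rw [hsplit, l2_add_add hP hQ, hPP, hPQ]; ring
  have hform : qform su2Rep β ψ ψ = qform su2Rep β P P + qform su2Rep β Q Q := by
    rw [hsplit, qform_add_add β hP hQ, hPKQ]; ring
  -- the span part: `Σ λ_i c_i² ≤ λ_k Σ c_i²`
  have hspan : qform su2Rep β P P ≤ lam k * ∑ i, c i ^ 2 := by
    rw [hPKP, Finset.mul_sum]
    refine Finset.sum_le_sum fun i _ => ?_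
    by_cases hik : (i : ℕ) < k
    · have : c i = 0 := by have h0 := hperp i hik; simp only [hcdef]; split_ifs; exacts [h0, rfl]
      rw [this]; simp
    · push Not at hik
      have hk' : k < n + 1 := Nat.lt_succ_of_le hkn
      have := hanti ⟨k, hk'⟩ i (by change k ≤ (i : ℕ); exact hik)
      exact mul_le_mul_of_nonneg_right this (sq_nonneg _)
  -- the rest: domination at index `n`
  have hrest : qform su2Rep β Q Q ≤ lam n * l2 Q Q := hdomn Q hQ hQe
  have hQQ : l2 Q Q = l2 ψ ψ - ∑ i, c i ^ 2 := by linarith [hnorm]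
  rw [hform]
  calc qform su2Rep β P P + qform su2Rep β Q Q ≤ lam k * ∑ i, c i ^ 2 + lam n * l2 Q Q := add_le_add hspan hrest
    _ = lam n * l2 ψ ψ + (lam k - lam n) * ∑ i, c i ^ 2 := by rw [hQQ]; ring

/-! ## §3 ★★★ Cluster absorption for a dressed test function -/

set_option maxHeartbeats 400000 in
/-- ★★★ **CLUSTER ABSORPTION.**  `β > 0`; `e₀,…,e_n` an `l2`-orthonormal physical exact eigenfamily with Courant–Fischer domination; `k ≤ n`; a bounded measurable gauge- and
twist-invariant weight `W` and window `S` with `|W² − 1| ≤ κ̄` on `S`; the DRESSED SECOND-MOMENT FORM of the eigenfamily on the window `∫_S |W²−1|(Σcᵢeᵢ)² ≤ V·Σcᵢ²` and the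
overlaps `Σᵢ ‖𝟙_S(W−1)eᵢ‖² ≤ w²`; and the GAP CONDITION `2κ̄λ_n ≤ λ_k − λ_n`.  Then every physical `Ψ` supported in `S` with `ΨW ⊥ e₀,…,e_{k−1}` satisfies
`⟨ΨW, K_β ΨW⟩ ≤ (λ_k + 2λ_nV + (λ_k − λ_n)(2w + w²))·‖Ψ‖²` (norm UNDRESSED).  The dressing excess off `span(e_{<n})` is absorbed by the gap; on the span it costs `V`, `w`.
[cite: ReedSimonIV1978, Thm. XIII.1] [cite: Luscher1983, §3] -/
theorem qform_dressed_le_of_cluster {β : ℝ} (hβ : 0 < β) {n : ℕ} {e : Fin (n + 1) → GaugeConfig 3 L SU2 → ℝ} (he : ∀ i, IsPhys (e i))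
    (hon : ∀ i l, l2 (e i) (e l) = if i = l then 1 else 0)
    (heig : ∀ i : Fin (n + 1), transferApply β (e i) = levelValue su2Rep L β (i : ℕ) • e i)
    (hdom : ∀ (j : Fin (n + 1)) (ψ : GaugeConfig 3 L SU2 → ℝ), IsPhys ψ → (∀ i : Fin (n + 1), i < j → l2 ψ (e i) = 0) →
      qform su2Rep β ψ ψ ≤ levelValue su2Rep L β j * l2 ψ ψ)
    {k : ℕ} (hkn : k ≤ n)
    {W : GaugeConfig 3 L SU2 → ℝ} (hWm : Measurable W) {CW : ℝ} (hWb : ∀ U, |W U| ≤ CW)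
    (hWg : ∀ (g : Site 3 L → SU2) (U : GaugeConfig 3 L SU2), W (gaugeTransform g U) = W U)
    (hWz : ∀ (j : Fin 3), ∀ z ∈ Subgroup.center SU2, ∀ U : GaugeConfig 3 L SU2, W (twist j z U) = W U)
    {S : Set (GaugeConfig 3 L SU2)} (hSm : MeasurableSet S)
    (hSg : ∀ (g : Site 3 L → SU2) (U : GaugeConfig 3 L SU2), gaugeTransform g U ∈ S ↔ U ∈ S)
    (hSz : ∀ (j : Fin 3), ∀ z ∈ Subgroup.center SU2, ∀ U : GaugeConfig 3 L SU2, twist j z U ∈ S ↔ U ∈ S)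
    {κ V w : ℝ} (hκ0 : 0 ≤ κ) (hκ : ∀ U ∈ S, |W U ^ 2 - 1| ≤ κ) (hV0 : 0 ≤ V)
    (hV : ∀ c : Fin (n + 1) → ℝ, ∫ U, S.indicator (fun U => |W U ^ 2 - 1|) U * (∑ i, c i * e i U) ^ 2 ∂configMeasure SU2 L ≤ V * ∑ i, c i ^ 2)
    (hw0 : 0 ≤ w) (hw : ∑ i : Fin (n + 1), l2 (fun U => S.indicator 1 U * (W U - 1) * e i U) (fun U => S.indicator 1 U * (W U - 1) * e i U) ≤ w ^ 2)
    (hgap : 2 * κ * levelValue su2Rep L β n ≤ levelValue su2Rep L β k - levelValue su2Rep L β n)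
    {Ψ : GaugeConfig 3 L SU2 → ℝ} (hΨ : IsPhys Ψ) (hΨS : ∀ U, Ψ U ≠ 0 → U ∈ S)
    (hperp : ∀ i : Fin (n + 1), (i : ℕ) < k → l2 (fun U => W U * Ψ U) (e i) = 0) :
    qform su2Rep β (fun U => W U * Ψ U) (fun U => W U * Ψ U) ≤
      (levelValue su2Rep L β k + 2 * levelValue su2Rep L β n * V + (levelValue su2Rep L β k - levelValue su2Rep L β n) * (2 * w + w ^ 2)) * l2 Ψ Ψ := by
  classical
  set lam : ℕ → ℝ := fun j => levelValue su2Rep L β j with hlam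
  -- the dressed test function is physical
  set ψ : GaugeConfig 3 L SU2 → ℝ := fun U => W U * Ψ U with hψdef
  have hψ : IsPhys ψ := hΨ.mul_of_invariant hWm hWb hWg hWz
  -- §2 applied to `ψ`
  have htwo := qform_le_two_level he hon heig hdom hkn hψ hperp
  -- the undressed coefficients `a_i = ⟨Ψ, e_i⟩` (`i < n`), the span part `P` and the rest `R`
  set a : Fin (n + 1) → ℝ := fun i => if (i : ℕ) < n then l2 Ψ (e i) else 0 with hadef
  set P : GaugeConfig 3 L SU2 → ℝ := fun U => ∑ i, a i * e i U with hPdef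
  have hP : IsPhys P := isPhys_sum_mul_lat Finset.univ e he a
  set R : GaugeConfig 3 L SU2 → ℝ := fun U => Ψ U - P U with hRdef
  have hR : IsPhys R := OpPlat.isPhys_sub hΨ hP
  set N : ℝ := l2 Ψ Ψ with hNdef
  set p : ℝ := ∑ i, a i ^ 2 with hpdef
  have hN0 : 0 ≤ N := l2_self_nonneg_lat Ψ
  have hp0 : 0 ≤ p := Finset.sum_nonneg fun i _ => sq_nonneg _
  have haa : ∀ i, a i * l2 Ψ (e i) = a i ^ 2 := fun i => by
    by_cases hi : (i : ℕ) < n <;> simp [hadef, hi, sq]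
  obtain ⟨hPP, -⟩ := forms_of_eigenfamily_lat he hon heig a
  have hΨP : l2 Ψ P = p := by
    rw [l2_comm, hPdef, l2_sum_mul_left_lat Finset.univ e he a hΨ]
    exact Finset.sum_congr rfl fun i _ => by rw [l2_comm]; exact haa i
  -- `‖R‖² = N − p`, hence `p ≤ N`
  have hRR : l2 R R = N - p := by
    have e1 : R = Ψ + (-1 : ℝ) • P := by funext U; simp only [hRdef, Pi.add_apply, Pi.smul_apply, smul_eq_mul]; ring
    have e2 : l2 Ψ ((-1 : ℝ) • P) = -1 * l2 Ψ P := by rw [l2_comm, l2_smul_left, l2_comm]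
    rw [e1, l2_add_add hΨ (hP.smul _), e2, OpPlat.l2_smul_smul, hΨP, hPP]; ring
  have hpN : p ≤ N := by have := l2_self_nonneg_lat R; linarith
  -- bounded-measurable data for the integral manipulations
  obtain ⟨CΨ, hCΨ⟩ := hΨ.bounded
  obtain ⟨CP, hCP⟩ := hP.bounded
  obtain ⟨CR, hCR⟩ := hR.bounded
  have hCΨ0 : 0 ≤ CΨ := (abs_nonneg _).trans (hCΨ 1)
  have hCW0 : 0 ≤ CW := (abs_nonneg _).trans (hWb 1)
  have hW21 : ∀ U, |W U ^ 2 - 1| ≤ CW ^ 2 + 1 := fun U => by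
    have h1 : |W U ^ 2| ≤ CW ^ 2 := by rw [abs_pow]; exact pow_le_pow_left₀ (abs_nonneg _) (hWb U) 2
    calc |W U ^ 2 - 1| ≤ |W U ^ 2| + |(1 : ℝ)| := abs_sub _ _
      _ ≤ CW ^ 2 + 1 := by rw [abs_one]; linarith
  have hindm : Measurable (S.indicator (fun U => |W U ^ 2 - 1|)) :=
    (((hWm.pow_const 2).sub measurable_const).abs).indicator hSm
  have hindb : ∀ U, |S.indicator (fun U => |W U ^ 2 - 1|) U| ≤ CW ^ 2 + 1 := fun U => by
    by_cases hU : U ∈ S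
    · rw [Set.indicator_of_mem hU, abs_abs]; exact hW21 U
    · rw [Set.indicator_of_notMem hU, abs_zero]; positivity
  have hindκ : ∀ U, S.indicator (fun U => |W U ^ 2 - 1|) U ≤ κ := fun U => by
    by_cases hU : U ∈ S
    · rw [Set.indicator_of_mem hU]; exact hκ U hU
    · rw [Set.indicator_of_notMem hU]; exact hκ0
  have hind0 : ∀ U, 0 ≤ S.indicator (fun U => |W U ^ 2 - 1|) U := fun U => by
    by_cases hU : U ∈ S
    · rw [Set.indicator_of_mem hU]; exact abs_nonneg _
    · rw [Set.indicator_of_notMem hU]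
  -- (i) `‖ΨW‖² = N + X`, `X = ∫ (W²−1)Ψ²`
  set X : ℝ := ∫ U, (W U ^ 2 - 1) * Ψ U ^ 2 ∂configMeasure SU2 L with hXdef
  have hψψ : l2 ψ ψ = N + X := by
    rw [l2_self_eq_integral_sq, hNdef, l2_self_eq_integral_sq, hXdef, ← integral_add]
    · exact integral_congr_ae (ae_of_all _ fun U => by simp only [hψdef]; ring)
    · exact integrable_of_measurable_abs_le _ (hΨ.measurable.pow_const 2) (C := CΨ ^ 2) fun U => by rw [abs_pow]; exact pow_le_pow_left₀ (abs_nonneg _) (hCΨ U) 2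
    · exact integrable_of_measurable_abs_le _ (((hWm.pow_const 2).sub measurable_const).mul (hΨ.measurable.pow_const 2)) (C := (CW ^ 2 + 1) * CΨ ^ 2) fun U => by
        rw [abs_mul, abs_pow]; exact mul_le_mul (hW21 U) (pow_le_pow_left₀ (abs_nonneg _) (hCΨ U) 2) (by positivity) (by positivity)
  -- (ii) `X ≤ 2Vp + 2κ̄(N − p)`
  have hX : X ≤ 2 * V * p + 2 * κ * (N - p) := by
    -- pointwise: `(W²−1)Ψ² ≤ 𝟙_S|W²−1|·(2P² + 2R²)`
    have hpt : ∀ U, (W U ^ 2 - 1) * Ψ U ^ 2 ≤ 2 * (S.indicator (fun U => |W U ^ 2 - 1|) U * P U ^ 2) + 2 * (S.indicator (fun U => |W U ^ 2 - 1|) U * R U ^ 2) := by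
      intro U
      by_cases hU : U ∈ S
      · rw [Set.indicator_of_mem hU]
        have hΨU : Ψ U = P U + R U := by simp only [hRdef]; ring
        have h1 : (W U ^ 2 - 1) * Ψ U ^ 2 ≤ |W U ^ 2 - 1| * Ψ U ^ 2 := mul_le_mul_of_nonneg_right (le_abs_self _) (sq_nonneg _)
        have h2 : Ψ U ^ 2 ≤ 2 * P U ^ 2 + 2 * R U ^ 2 := by rw [hΨU]; nlinarith [sq_nonneg (P U - R U)]
        nlinarith [mul_le_mul_of_nonneg_left h2 (abs_nonneg (W U ^ 2 - 1))]
      · have hΨ0 : Ψ U = 0 := by by_contra h; exact hU (hΨS U h)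
        rw [hΨ0, Set.indicator_of_notMem hU]; simp
    have hiX : Integrable (fun U => (W U ^ 2 - 1) * Ψ U ^ 2) (configMeasure SU2 L) :=
      integrable_of_measurable_abs_le _ (((hWm.pow_const 2).sub measurable_const).mul (hΨ.measurable.pow_const 2)) (C := (CW ^ 2 + 1) * CΨ ^ 2) fun U => by
        rw [abs_mul, abs_pow]; exact mul_le_mul (hW21 U) (pow_le_pow_left₀ (abs_nonneg _) (hCΨ U) 2) (by positivity) (by positivity)
    have hiP : Integrable (fun U => S.indicator (fun U => |W U ^ 2 - 1|) U * P U ^ 2) (configMeasure SU2 L) :=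
      integrable_of_measurable_abs_le _ (hindm.mul (hP.measurable.pow_const 2)) (C := (CW ^ 2 + 1) * CP ^ 2) fun U => by
        rw [abs_mul, abs_pow]; exact mul_le_mul (hindb U) (pow_le_pow_left₀ (abs_nonneg _) (hCP U) 2) (by positivity) (by positivity)
    have hiR : Integrable (fun U => S.indicator (fun U => |W U ^ 2 - 1|) U * R U ^ 2) (configMeasure SU2 L) :=
      integrable_of_measurable_abs_le _ (hindm.mul (hR.measurable.pow_const 2)) (C := (CW ^ 2 + 1) * CR ^ 2) fun U => by
        rw [abs_mul, abs_pow]; exact mul_le_mul (hindb U) (pow_le_pow_left₀ (abs_nonneg _) (hCR U) 2) (by positivity) (by positivity)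
    have hint : X ≤ 2 * ∫ U, S.indicator (fun U => |W U ^ 2 - 1|) U * P U ^ 2 ∂configMeasure SU2 L +
        2 * ∫ U, S.indicator (fun U => |W U ^ 2 - 1|) U * R U ^ 2 ∂configMeasure SU2 L := by
      rw [hXdef, ← integral_const_mul, ← integral_const_mul, ← integral_add (hiP.const_mul 2) (hiR.const_mul 2)]
      exact integral_mono hiX ((hiP.const_mul 2).add (hiR.const_mul 2)) fun U => hpt U
    -- the span piece by `hV`, the rest by `κ̄`
    have hVP : ∫ U, S.indicator (fun U => |W U ^ 2 - 1|) U * P U ^ 2 ∂configMeasure SU2 L ≤ V * p := hV a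
    have hκR : ∫ U, S.indicator (fun U => |W U ^ 2 - 1|) U * R U ^ 2 ∂configMeasure SU2 L ≤ κ * (N - p) := by
      rw [← hRR, l2_self_eq_integral_sq, ← integral_const_mul]
      refine integral_mono hiR ((integrable_of_measurable_abs_le _ (hR.measurable.pow_const 2) (C := CR ^ 2) fun U => by
        rw [abs_pow]; exact pow_le_pow_left₀ (abs_nonneg _) (hCR U) 2).const_mul κ) fun U => ?_
      exact mul_le_mul_of_nonneg_right (hindκ U) (sq_nonneg _)
    linarith [hint, hVP, hκR]
  -- (iii) the dressed coefficients: `⟨ΨW, e_i⟩ = a_i + ε_i` for `i < n`, `Σ ε_i² ≤ w²N`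
  set J : Fin (n + 1) → GaugeConfig 3 L SU2 → ℝ := fun i U => S.indicator 1 U * (W U - 1) * e i U with hJdef
  have hJphys : ∀ i, IsPhys (J i) := by
    intro i
    have hm : Measurable (fun U => S.indicator (1 : GaugeConfig 3 L SU2 → ℝ) U * (W U - 1)) :=
      ((measurable_const.indicator hSm).mul (hWm.sub measurable_const))
    have hb : ∀ U, |S.indicator (1 : GaugeConfig 3 L SU2 → ℝ) U * (W U - 1)| ≤ CW + 1 := fun U => by
      rw [abs_mul]
      have h1 : |S.indicator (1 : GaugeConfig 3 L SU2 → ℝ) U| ≤ 1 := by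
        by_cases hU : U ∈ S
        · rw [Set.indicator_of_mem hU]; simp
        · rw [Set.indicator_of_notMem hU]; simp
      have h2 : |W U - 1| ≤ CW + 1 := (abs_sub _ _).trans (by rw [abs_one]; linarith [hWb U])
      calc |S.indicator (1 : GaugeConfig 3 L SU2 → ℝ) U| * |W U - 1| ≤ 1 * (CW + 1) := mul_le_mul h1 h2 (abs_nonneg _) zero_le_one
        _ = CW + 1 := one_mul _
    have hg' : ∀ (g : Site 3 L → SU2) (U : GaugeConfig 3 L SU2),
        S.indicator (1 : GaugeConfig 3 L SU2 → ℝ) (gaugeTransform g U) * (W (gaugeTransform g U) - 1) = S.indicator 1 U * (W U - 1) := fun g U => by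
      rw [hWg g U]
      by_cases hU : U ∈ S
      · rw [Set.indicator_of_mem hU, Set.indicator_of_mem ((hSg g U).mpr hU), Pi.one_apply, Pi.one_apply]
      · rw [Set.indicator_of_notMem hU, Set.indicator_of_notMem (fun h => hU ((hSg g U).mp h))]
    have hz' : ∀ (j : Fin 3), ∀ z ∈ Subgroup.center SU2, ∀ U : GaugeConfig 3 L SU2,
        S.indicator (1 : GaugeConfig 3 L SU2 → ℝ) (twist j z U) * (W (twist j z U) - 1) = S.indicator 1 U * (W U - 1) := fun j z hz U => by
      rw [hWz j z hz U]
      by_cases hU : U ∈ S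
      · rw [Set.indicator_of_mem hU, Set.indicator_of_mem ((hSz j z hz U).mpr hU), Pi.one_apply, Pi.one_apply]
      · rw [Set.indicator_of_notMem hU, Set.indicator_of_notMem (fun h => hU ((hSz j z hz U).mp h))]
    have := (he i).mul_of_invariant hm hb hg' hz'
    simpa only [hJdef, mul_assoc] using this
  have hcoef : ∀ i : Fin (n + 1), l2 ψ (e i) = l2 Ψ (e i) + l2 Ψ (J i) := by
    intro i
    obtain ⟨Ce, hCe⟩ := (he i).bounded
    obtain ⟨CJ, hCJ⟩ := (hJphys i).bounded
    have hi1 : Integrable (fun U => Ψ U * e i U) (configMeasure SU2 L) :=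
      integrable_of_measurable_abs_le _ (hΨ.measurable.mul (he i).measurable) (C := CΨ * Ce) fun U => by
        rw [abs_mul]; exact mul_le_mul (hCΨ U) (hCe U) (abs_nonneg _) hCΨ0
    have hi2 : Integrable (fun U => Ψ U * J i U) (configMeasure SU2 L) :=
      integrable_of_measurable_abs_le _ (hΨ.measurable.mul (hJphys i).measurable) (C := CΨ * CJ) fun U => by
        rw [abs_mul]; exact mul_le_mul (hCΨ U) (hCJ U) (abs_nonneg _) hCΨ0
    unfold l2
    rw [← integral_add hi1 hi2]
    refine integral_congr_ae (ae_of_all _ fun U => ?_)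
    by_cases hU : U ∈ S
    · simp only [hψdef, hJdef, Set.indicator_of_mem hU, Pi.one_apply]; ring
    · have hΨ0 : Ψ U = 0 := by by_contra h; exact hU (hΨS U h)
      simp only [hψdef, hΨ0]; ring
  set ε : Fin (n + 1) → ℝ := fun i => if (i : ℕ) < n then l2 Ψ (J i) else 0 with hεdef
  have hcε : ∀ i : Fin (n + 1), (if (i : ℕ) < n then l2 ψ (e i) else 0) = a i + ε i := fun i => by
    by_cases hi : (i : ℕ) < n
    · simp only [hadef, hεdef, hi, if_true, hcoef i]
    · simp only [hadef, hεdef, hi, if_false, add_zero]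
  have hε2 : ∑ i, ε i ^ 2 ≤ w ^ 2 * N := by
    have hεi : ∀ i, ε i ^ 2 ≤ l2 (J i) (J i) * N := fun i => by
      by_cases hi : (i : ℕ) < n
      · simp only [hεdef, hi, if_true]
        have := sq_l2_le hΨ (hJphys i)
        rw [hNdef]; linarith
      · simp only [hεdef, hi, if_false]
        rw [zero_pow two_ne_zero]; exact mul_nonneg (l2_self_nonneg_lat _) hN0
    calc ∑ i, ε i ^ 2 ≤ ∑ i, l2 (J i) (J i) * N := Finset.sum_le_sum fun i _ => hεi i
      _ = (∑ i, l2 (J i) (J i)) * N := by rw [Finset.sum_mul]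
      _ ≤ w ^ 2 * N := mul_le_mul_of_nonneg_right hw hN0
  have hc2 : ∑ i : Fin (n + 1), (if (i : ℕ) < n then l2 ψ (e i) else 0) ^ 2 ≤ (Real.sqrt p + w * Real.sqrt N) ^ 2 := by
    have e1 : ∑ i : Fin (n + 1), (if (i : ℕ) < n then l2 ψ (e i) else 0) ^ 2 = ∑ i, (a i + ε i) ^ 2 :=
      Finset.sum_congr rfl fun i _ => by rw [hcε i]
    rw [e1]
    refine (sum_add_sq_le Finset.univ a ε).trans ?_
    have hsq : Real.sqrt (∑ i, ε i ^ 2) ≤ w * Real.sqrt N := by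
      rw [← Real.sqrt_sq hw0, ← Real.sqrt_mul (sq_nonneg w)]
      exact Real.sqrt_le_sqrt hε2
    have h0 : 0 ≤ Real.sqrt p + Real.sqrt (∑ i, ε i ^ 2) := by positivity
    exact pow_le_pow_left₀ h0 (by linarith) 2
  -- endgame
  have hln0 : 0 ≤ lam n := (levelValue_su2Rep_pos (L := L) hβ n).le
  have hlkn : lam n ≤ lam k := by
    have hq : qform su2Rep β (e (Fin.last n)) (e (Fin.last n)) = lam n := by
      rw [qform_eigen_right β (heig _), hon]; simp [hlam, Fin.val_last]
    have h1 : l2 (e (Fin.last n)) (e (Fin.last n)) = 1 := by rw [hon]; simp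
    have hk' : k < n + 1 := Nat.lt_succ_of_le hkn
    have h := hdom ⟨k, hk'⟩ (e (Fin.last n)) (he _) (fun i' hi' => by
      rw [hon]
      have : Fin.last n ≠ i' := fun h => by
        have h2 : (i' : ℕ) < k := hi'
        rw [← h, Fin.val_last] at h2
        omega
      simp [this])
    rw [hq, h1, mul_one] at h
    exact h
  have hQ : qform su2Rep β ψ ψ ≤ lam n * (N + X) + (lam k - lam n) * ∑ i : Fin (n + 1), (if (i : ℕ) < n then l2 ψ (e i) else 0) ^ 2 := by
    rw [← hψψ]; exact htwo
  exact absorb_arith hN0 hp0 hpN hV0 hw0 hln0 hlkn hgap hX hc2 hQ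

end Summit.QuantumFields.YangMills.Theorems.FemtoTransferGap.RateTube

end
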